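import Mathlib.RingTheory.GradedAlgebra.Radical
import Mathlib.Algebra.Order.Group.PiLex
import Mathlib.Order.PiLex
import HarnessLib

/-!
# E2 centre, ring-level hand (G-0), parts (a)+(b): the HOMOGENEOUS SHRINK — an open condition around a
# homogeneous prime whose failure set is stable under passage to homogeneous cores holds on a HOMOGENEOUS basic
# open neighbourhood

[OURS · L1 W4.3 · DOOR `HypersurfaceCentreConstruction` stmt-ResolutionOfSingularities-19897 · E2 tier, centre piece
(C-c) `E2CentreGlueBody`, DESIGN MEMO v0 `L/res-L1-w43-plan-1/E2-CENTRE-GLUE-DESIGN-v0.md` (registrar res-L1-w43-plan-1)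
§2 (G-0) HOMOGENEOUS CHART; ring-level hand res-L1-s36-pv-1, SHAPE LINE (HOME/STATUS 2026-08-27 ≈20:2xZ) parts (a)+(b).
Pure graded commutative algebra (Mathlib `GradedRing`, `Ideal.homogeneousCore`); nothing here is a statement of, or
about, the manuscript under adjudication (Hironaka 2017); candidate-design support, AI-written, weaker than expert review.]

## The mechanism

`A` graded by `𝒜 : ι → σ`, `P` a HOMOGENEOUS prime (an orbit-generic point of a unit chart), `h ∉ P` (the element of
(open″)≤3), and `Bad` a set of ideals (the primes of local dimension `≤ 3` at which the presentation clause fails) with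
`Bad ⊆ V(h)`.  If `Bad` is CORE-STABLE — `𝔮 ∈ Bad ⇒ 𝔮* ∈ Bad`, `𝔮* = Ideal.homogeneousCore 𝒜 𝔮` the largest
homogeneous ideal inside `𝔮` (the generic point of the torus-orbit closure of `𝔮`) — then `h ∈ 𝔮*` for every
`𝔮 ∈ Bad`, so EVERY homogeneous component `h_d` lies in every `𝔮 ∈ Bad`, and some `h_d ∉ P` because `P` is
homogeneous: `Bad ⊆ V(h_d)` with `h_d` HOMOGENEOUS, `h_d ∉ P` — the SAME presentation data, only `h` changes
(`exists_decompose_not_mem_forall_mem`, part (a)).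

Core-stability of `Bad` for a clause of the shape `Clause(𝔮) = ((I_U ≤ 𝔮) ↔ Top 𝔮) ∧ ((I_U ≤ 𝔮) → Jeq 𝔮)` guarded by
`dimOK 𝔮` follows by case analysis from: `I_U` HOMOGENEOUS, `dimOK` descends to cores, `Top 𝔮 ↔ Top 𝔮*`, and
`I_U ≤ 𝔮* → Jeq 𝔮* → Jeq 𝔮` (`not_clause_homogeneousCore`, part (b)); for `ℤʲ`-gradings the core of a prime is prime
(`isPrime_homogeneousCore`, Lex transport as in `…HomogeneousMinimalPrimes`), whence the packaged statement
`exists_isHomogeneousElem_forall_clause`: the clause holds on `D(h')` for a HOMOGENEOUS `h' ∉ P`.  Part (c) — the two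
invariances from the rung via the generic torus translate — is the sequel file.
-/

set_option linter.dupNamespace false

noncomputable section

open SetLike DirectSum

namespace Summit.ResolutionOfSingularities.ResolutionOfSingularities.Cruxes.HypersurfaceCentreConstruction.LocalEngine

namespace E2Model

universe u

/-! ## §1 Membership in the homogeneous core; part (a): the homogeneous shrink -/

section AnyGrading

variable {ι σ A : Type*} [CommRing A] [SetLike σ A] [AddSubmonoidClass σ A] (𝒜 : ι → σ)
  [DecidableEq ι] [AddMonoid ι] [GradedRing 𝒜]

/-- `x` lies in the homogeneous core of `I` iff all its homogeneous components lie in `I`. [OURS · folklore bookkeeping] -/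
theorem mem_homogeneousCore_iff_forall_decompose (I : Ideal A) (x : A) :
    x ∈ (I.homogeneousCore 𝒜).toIdeal ↔ ∀ d, (decompose 𝒜 x d : A) ∈ I := by
  constructor
  · intro hx d
    exact Ideal.toIdeal_homogeneousCore_le 𝒜 I ((I.homogeneousCore 𝒜).isHomogeneous d hx)
  · intro hx
    classical
    rw [← DirectSum.sum_support_decompose 𝒜 x]
    exact Ideal.sum_mem _ fun d _ =>
      Ideal.mem_homogeneousCore_of_homogeneous_of_mem (isHomogeneousElem_coe _) (hx d)

/-- An element outside a HOMOGENEOUS ideal has a homogeneous component outside it. [OURS · folklore bookkeeping] -/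
theorem exists_decompose_not_mem {P : Ideal A} (hP : P.IsHomogeneous 𝒜) {h : A} (hh : h ∉ P) :
    ∃ d, (decompose 𝒜 h d : A) ∉ P := by
  by_contra hall
  simp only [not_exists, not_not] at hall
  exact hh ((hP.mem_iff 𝒜).mpr hall)

/-- **Part (a): THE HOMOGENEOUS SHRINK.**  `P` homogeneous, `h ∉ P`, `Bad ⊆ V(h)` and `Bad` stable under
`𝔮 ↦ 𝔮* = homogeneousCore 𝔮` ⟹ some homogeneous component `h_d` of `h` has `h_d ∉ P` and `Bad ⊆ V(h_d)`.
(`𝔮 ∈ Bad ⇒ 𝔮* ∈ Bad ⇒ h ∈ 𝔮* ⇒ h_d ∈ 𝔮* ≤ 𝔮`.) [OURS · DESIGN MEMO v0 §2 (G-0), part (a)] -/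
theorem exists_decompose_not_mem_forall_mem {P : Ideal A} (hP : P.IsHomogeneous 𝒜) {h : A} (hh : h ∉ P)
    (Bad : Set (Ideal A)) (hBad : ∀ 𝔮 ∈ Bad, h ∈ 𝔮)
    (hcore : ∀ 𝔮 ∈ Bad, (𝔮.homogeneousCore 𝒜).toIdeal ∈ Bad) :
    ∃ d, (decompose 𝒜 h d : A) ∉ P ∧ ∀ 𝔮 ∈ Bad, (decompose 𝒜 h d : A) ∈ 𝔮 := by
  obtain ⟨d, hd⟩ := exists_decompose_not_mem 𝒜 hP hh
  refine ⟨d, hd, fun 𝔮 h𝔮 => ?_⟩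
  have hmem : h ∈ (𝔮.homogeneousCore 𝒜).toIdeal := hBad _ (hcore 𝔮 h𝔮)
  exact (mem_homogeneousCore_iff_forall_decompose 𝒜 𝔮 h).mp hmem d

/-! ## §2 Part (b): core-stability of the failure set of a presentation clause -/

/-- **Part (b): CORE-STABILITY OF THE FAILURE SET.**  For a clause of the shape
`Clause 𝔮 = ((I_U ≤ 𝔮) ↔ Top 𝔮) ∧ ((I_U ≤ 𝔮) → Jeq 𝔮)` — the (iff)- and (J)-clauses of (open″) with `I_U = (U)` —
with `I_U` HOMOGENEOUS: if `Top` is core-invariant at `𝔮` and `Jeq` descends from the core when `I_U ≤ 𝔮*`, then failure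
of the clause at `𝔮` forces failure at `𝔮*`.  (Case `I_U ≤ 𝔮*`: `Top`/`Jeq` at `𝔮*` would transfer down; case
`I_U ≰ 𝔮*` ⇒ `I_U ≰ 𝔮` by homogeneity, and `¬Top 𝔮*` ⇒ `¬Top 𝔮`.)  WITHOUT homogeneity of `I_U` this fails: a prime
`𝔮 ⊇ I_U` with `𝔮* ⊉ I_U` has `¬Top 𝔮` forced. [OURS · DESIGN MEMO v0 §2 (G-0), part (b)] -/
theorem not_clause_homogeneousCore {I : Ideal A} (hI : I.IsHomogeneous 𝒜) (Top Jeq : Ideal A → Prop)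
    {𝔮 : Ideal A} (hTop : Top 𝔮 ↔ Top (𝔮.homogeneousCore 𝒜).toIdeal)
    (hJ : I ≤ (𝔮.homogeneousCore 𝒜).toIdeal → Jeq (𝔮.homogeneousCore 𝒜).toIdeal → Jeq 𝔮)
    (hbad : ¬ ((I ≤ 𝔮 ↔ Top 𝔮) ∧ (I ≤ 𝔮 → Jeq 𝔮))) :
    ¬ ((I ≤ (𝔮.homogeneousCore 𝒜).toIdeal ↔ Top (𝔮.homogeneousCore 𝒜).toIdeal) ∧
        (I ≤ (𝔮.homogeneousCore 𝒜).toIdeal → Jeq (𝔮.homogeneousCore 𝒜).toIdeal)) := by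
  rintro ⟨hiff, hjc⟩
  apply hbad
  -- `I ≤ 𝔮 ↔ I ≤ 𝔮*` by homogeneity of `I`
  have hIcore : I ≤ 𝔮 ↔ I ≤ (𝔮.homogeneousCore 𝒜).toIdeal := by
    constructor
    · intro hle
      rw [← hI.toIdeal_homogeneousCore_eq_self]
      exact Ideal.homogeneousCore_mono 𝒜 hle
    · intro hle
      exact hle.trans (Ideal.toIdeal_homogeneousCore_le 𝒜 𝔮)
  refine ⟨?_, ?_⟩
  · rw [hIcore, hiff, hTop]
  · intro hle
    have hle' := hIcore.mp hle
    exact hJ hle' (hjc hle')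

end AnyGrading

/-! ## §3 `ℤʲ`-gradings: the homogeneous core of a prime is prime; the packaged statement -/

section Pi

variable {j : ℕ} {A : Type u} [CommRing A] (𝒜 : (Fin j → ℤ) → AddSubgroup A) [GradedRing 𝒜]

/-- **The homogeneous core of a prime ideal of a `ℤʲ`-graded ring is prime** (the generic point of the torus-orbit
closure).  Mathlib's `Ideal.IsPrime.homogeneousCore` for a linearly ordered cancellative index monoid, transported along
the lexicographic order on `ℤʲ` exactly as in `…HomogeneousMinimalPrimes.isHomogeneous_of_mem_minimalPrimes`.
[OURS · folklore transport] -/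
theorem isPrime_homogeneousCore {𝔮 : Ideal A} (h𝔮 : 𝔮.IsPrime) : (𝔮.homogeneousCore 𝒜).toIdeal.IsPrime := by
  -- the decidability instance of the grading (captured before any linear order is in scope)
  let decPi : DecidableEq (Fin j → ℤ) := inferInstance
  -- the lexicographic order on `ℤʲ`, re-packaged with that decidability instance
  let loLex : LinearOrder (Fin j → ℤ) := (inferInstance : LinearOrder (Lex (Fin j → ℤ)))
  letI lo : LinearOrder (Fin j → ℤ) :=
    { loLex with
      toDecidableEq := decPi
      compare_eq_compareOfLessAndEq := fun a b => by
        rw [loLex.compare_eq_compareOfLessAndEq a b]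
        congr 1 }
  have inst : @IsOrderedCancelAddMonoid (Fin j → ℤ) _ lo.toPartialOrder.toPreorder :=
    (inferInstance : IsOrderedCancelAddMonoid (Lex (Fin j → ℤ)))
  let gr : @GradedRing (Fin j → ℤ) A (AddSubgroup A) (fun a b => lo.toDecidableEq a b) _ _ _ _ 𝒜 :=
    ‹GradedRing 𝒜›
  have key := @Ideal.IsPrime.homogeneousCore (Fin j → ℤ) (AddSubgroup A) A _ _ lo inst _ _ 𝒜 gr 𝔮 h𝔮
  exact key

/-- **(G-0), parts (a)+(b) packaged: THE CLAUSE HOLDS ON A HOMOGENEOUS BASIC OPEN NEIGHBOURHOOD.**  `ℤʲ`-graded `A`,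
`P` a homogeneous prime, `I` a homogeneous ideal (`= (U)` with homogeneous `Uᵢ`), predicates `Top`, `Jeq`, `dimOK` on
ideals with: `dimOK` descends to homogeneous cores of primes, `Top` is core-invariant at `dimOK` primes, and `Jeq`
descends from the core at `dimOK` primes containing `I` in their core.  If the clause
`((I ≤ 𝔮) ↔ Top 𝔮) ∧ ((I ≤ 𝔮) → Jeq 𝔮)` holds at every `dimOK` prime of `D(h)` for some `h ∉ P`, then it holds at every
`dimOK` prime of `D(h')` for some HOMOGENEOUS `h' ∉ P` (a homogeneous component of `h`).
[OURS · DESIGN MEMO v0 §2 (G-0), parts (a)+(b)] -/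
theorem exists_isHomogeneousElem_forall_clause {P : Ideal A} (hP : P.IsHomogeneous 𝒜) {I : Ideal A}
    (hI : I.IsHomogeneous 𝒜) (Top Jeq dimOK : Ideal A → Prop)
    (hdim : ∀ 𝔮 : Ideal A, 𝔮.IsPrime → dimOK 𝔮 → dimOK (𝔮.homogeneousCore 𝒜).toIdeal)
    (hTop : ∀ 𝔮 : Ideal A, 𝔮.IsPrime → dimOK 𝔮 → (Top 𝔮 ↔ Top (𝔮.homogeneousCore 𝒜).toIdeal))
    (hJ : ∀ 𝔮 : Ideal A, 𝔮.IsPrime → dimOK 𝔮 → I ≤ (𝔮.homogeneousCore 𝒜).toIdeal →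
      Jeq (𝔮.homogeneousCore 𝒜).toIdeal → Jeq 𝔮)
    {h : A} (hh : h ∉ P)
    (hgood : ∀ 𝔮 : Ideal A, 𝔮.IsPrime → dimOK 𝔮 → h ∉ 𝔮 → (I ≤ 𝔮 ↔ Top 𝔮) ∧ (I ≤ 𝔮 → Jeq 𝔮)) :
    ∃ h' : A, h' ∉ P ∧ SetLike.IsHomogeneousElem 𝒜 h' ∧
      ∀ 𝔮 : Ideal A, 𝔮.IsPrime → dimOK 𝔮 → h' ∉ 𝔮 → (I ≤ 𝔮 ↔ Top 𝔮) ∧ (I ≤ 𝔮 → Jeq 𝔮) := by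
  classical
  -- the failure set
  set Bad : Set (Ideal A) :=
    {𝔮 | 𝔮.IsPrime ∧ dimOK 𝔮 ∧ ¬ ((I ≤ 𝔮 ↔ Top 𝔮) ∧ (I ≤ 𝔮 → Jeq 𝔮))} with hBad_def
  have hBad : ∀ 𝔮 ∈ Bad, h ∈ 𝔮 := by
    rintro 𝔮 ⟨h𝔮, hd, hbad⟩
    by_contra hh𝔮
    exact hbad (hgood 𝔮 h𝔮 hd hh𝔮)
  have hcore : ∀ 𝔮 ∈ Bad, (𝔮.homogeneousCore 𝒜).toIdeal ∈ Bad := by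
    rintro 𝔮 ⟨h𝔮, hd, hbad⟩
    exact ⟨isPrime_homogeneousCore 𝒜 h𝔮, hdim 𝔮 h𝔮 hd,
      not_clause_homogeneousCore 𝒜 hI Top Jeq (hTop 𝔮 h𝔮 hd) (hJ 𝔮 h𝔮 hd) hbad⟩
  obtain ⟨d, hdP, hdBad⟩ := exists_decompose_not_mem_forall_mem 𝒜 hP hh Bad hBad hcore
  refine ⟨decompose 𝒜 h d, hdP, isHomogeneousElem_coe _, fun 𝔮 h𝔮 hd' hh' => ?_⟩
  by_contra hbad
  exact hh' (hdBad 𝔮 ⟨h𝔮, hd', hbad⟩)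

end Pi

end E2Model

end Summit.ResolutionOfSingularities.ResolutionOfSingularities.Cruxes.HypersurfaceCentreConstruction.LocalEngine

end
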